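import Mathlib
import HarnessLib
import Literature.Dynamics.TransferOperators.EisensteinProjection
import Summits.RiemannHypothesis.Statement
import Summits.RiemannHypothesis.RiemannHypothesis.Theses.MayerPairing

/-!
# RiemannHypothesis / MayerPairing — crux `UnitCircleCrossedOnce` (stmt-RiemannHypothesis-1470):
# the two exact Eisenstein identities of line `Ideator2FirstLemmas`, in the line's signatures

Route `RiemannHypothesis/MayerPairing`, helper file (supports item 1470) of the line lead
prover-line-stmt-RiemannHypothesis-1470-0, 2026-08-16. Sorry-free, Mathlib + Literature only.

The crux-chain line `Cruxes/UnitCircleCrossedOnce/Ideator2FirstLemmas.lean` states, among its first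
lemmas for the repaired crux W1 (exact eigenvalue `1` at the left end, modulus `1` at the right end;
bridge `mayerPairing_riemannHypothesis_of_exactLeft` in tree), two exact identities for Mayer's
operator `L_s = mayerTransfer s` on `B(D)`:

* `EisensteinProjectionIdentity` — for `0 < Re s < 1/2` and every left eigenfunctional
  `ℓ ∘ L_s = μ ℓ`: `(μ − 1) ℓ(h_s) = −(ζ(2s)/2) ℓ(𝟙)`, `h_s(z) = ψ(2s, z+1)`;
* `ResolventAtOne` — for `0 < Re s < 1/2`, `ζ(2s) ≠ 0`, `1 − L_s` injective and `(1 − L_s) G = 𝟙`: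
  `G(0) = 2 ζ(2s−1)/ζ(2s)`.

Both are now theorems of the tree (`Literature/Dynamics/TransferOperators/EisensteinProjection.lean`,
corollaries of the Chang–Mayer identity `L_s h_s = h_s − ζ(2s)/2`, [ChangMayer2001, (4.36)–(4.38)]).
This file restates them with EXACTLY the line's stub signatures (universally quantified form), so a
skeleton importing it closes `stub_eisensteinProjectionIdentity` / `stub_resolventAtOne` by `exact`.

* `mayerPairing_eisensteinProjectionIdentity`
* `mayerPairing_resolventAtOne`
-/

namespace Summit.RiemannHypothesis.RiemannHypothesis.Theorems

open Complex
open Literature.Dynamics.TransferOperators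

/-- **Eisenstein projection identity** (signature of stub `EisensteinProjectionIdentity` of line
`Ideator2FirstLemmas`, crux stmt-RiemannHypothesis-1470): on the open strip `0 < Re s < 1/2`, every
left eigenfunctional `ℓ ∘ L_s = μ ℓ` of Mayer's transfer operator on `B(D)` satisfies
`(μ − 1) ℓ(H) = −(ζ(2s)/2) ℓ(E)` for `H = ψ(2s, ·+1)` and `E = 1` on the closed disc. Consequence
used by the route: an eigenvalue branch with `ℓ(H) ≠ 0` reads `λ = 1 − (ζ(2s)/2) ℓ(E)/ℓ(H)` and passes
through `1` exactly at the zeros of `ζ(2s)`. [folklore] -/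
theorem mayerPairing_eisensteinProjectionIdentity :
    ∀ s : ℂ, 0 < s.re → s.re < 1 / 2 → ∀ (ℓ : MayerSpace →L[ℂ] ℂ) (μ : ℂ),
      ℓ.comp (mayerTransfer s) = μ • ℓ →
      ∀ H : MayerSpace, (∀ z ∈ mayerClosedDisc, H.toFun z = zagierPsi (2 * s) (z + 1)) →
      ∀ E : MayerSpace, (∀ z ∈ mayerClosedDisc, E.toFun z = 1) →
      (μ - 1) * ℓ H = -(riemannZeta (2 * s) / 2) * ℓ E :=
  fun _s hs0 hs1 ℓ μ hℓ _H hH _E hE =>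
    eisenstein_projection_identity_of_strip hs0 hs1 ℓ μ hℓ _ hH _ hE

/-- **Resolvent matrix element at `μ = 1`** (signature of stub `ResolventAtOne` of line
`Ideator2FirstLemmas`, crux stmt-RiemannHypothesis-1470): on the open strip, if `ζ(2s) ≠ 0`,
`1 − L_s` is injective and `G − L_s G = E` with `E = 1` on the closed disc, then
`G(0) = 2 ζ(2s−1)/ζ(2s)` (indeed `G = (2/ζ(2s)) • h_s`, `h_s(0) = ψ(2s, 1) = ζ(2s−1)`). [folklore] -/
theorem mayerPairing_resolventAtOne :
    ∀ s : ℂ, 0 < s.re → s.re < 1 / 2 → riemannZeta (2 * s) ≠ 0 →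
      (∀ f : MayerSpace, mayerTransfer s f = f → f = 0) →
      ∀ G E : MayerSpace, (∀ z ∈ mayerClosedDisc, E.toFun z = 1) →
      G - mayerTransfer s G = E →
      G.toFun 0 = 2 * riemannZeta (2 * s - 1) / riemannZeta (2 * s) :=
  fun _s hs0 hs1 hζ hinj G E hE hG => resolvent_one_apply_zero hs0 hs1 hζ hinj G E hE hG

end Summit.RiemannHypothesis.RiemannHypothesis.Theorems
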